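import Summits.QuantumAdvantage.QuantumAdvantage.Theorems.EchoDialC

/-! # EchoDialD — part 4/5 of the landing twins of NODE «EchoDial» (decomp-qadv lens-2; node file
`g22/EchoDial.lean`, sha256 2019ca7807e3a40c…; generator `g23/tree/gen_twins.py`: namespace
`Theses.EchoDial` → `Theorems.EchoDial`, cut at declaration boundaries, docstrings added where missing, nothing else).
Content: §5(a,b,c-part-1) the residual inhabitant `hxStrat` (half-counter × literal pair): dense, NOT counter-form at the zero
gauge (`hx_not_counterForm_zero`, finite core by `decide`), and the sub-orbit restriction lemmas for the high-echo certificate. -/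

set_option linter.dupNamespace false
noncomputable section
open scoped Classical

namespace Summit.QuantumAdvantage.QuantumAdvantage.Theorems.EchoDial
open Finset
open Literature.Computability.QuantumComplexity Literature.Computability.QuantumComplexity.RingHLF
open Literature.Computability.MetaComplexity Literature.Computability.MetaComplexity.Smolensky
open Summit.QuantumAdvantage.AdviceFreeQNC0 hiding sgn3
open Summit.QuantumAdvantage.QuantumAdvantage.Theorems.AnchorDial (outB dev cN orbF cN_orbF_cast oddZeros_orbF
  orbF_apply_of_far card_filter_orbF orbF_false win_iff gCond_iff_cN three_counts card_odd_ge loss_shape_mono)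
open Summit.QuantumAdvantage.QuantumAdvantage.Theorems.AnchorDial.Core (ct sg)
open Summit.QuantumAdvantage.QuantumAdvantage.Theorems.HolonomyDial (gCond card_odd_le)
open Summit.QuantumAdvantage.QuantumAdvantage.Theorems.StabilizerDial (pad pad_mem rel_pad_iff StabFew apStrat apStrat_mem)
open Summit.QuantumAdvantage.QuantumAdvantage.Theorems.SparsityDial (stabFew_mono_mr one_le_logpow)
open Summit.QuantumAdvantage.QuantumAdvantage.Theorems.ResponseDial (lodd lodd_mem lodd_eq_sum qpoly qpoly_mem qbit qpoly_apply
  hcStrat mem_dev_hcStrat_iff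
  sgn3 sgn3_ne dev_pad_zero not_polylogSparse_of_agree orbF_apply mod3_ne_two castZ2_of_mod_eq_zero
  castZ2_of_mod_eq_one εOf sF lam CertOK certOK_lam AddResp)
open Summit.QuantumAdvantage.QuantumAdvantage.Theses.SparsityDial (DenseGenericLoss3)
open Summit.QuantumAdvantage.QuantumAdvantage.Theorems.CounterDial (StabCounter CounterLoss3 NonCounterGenericLoss3 lin CounterForm
  xloc xloc_castLE oddZeros_xloc lin_xloc bsel mem_iff_bsel card_false_five)
open Summit.QuantumAdvantage.QuantumAdvantage.Theorems.HolonomyDial (tPoly tPoly_mem tPoly_apply xorP xorP_mem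
  xorP_apply_bool mono_singleton_apply)

/-! ## §5  AN INHABITANT OF THE RESIDUAL: the HALF-COUNTER × LITERAL-PAIR family `hxStrat`
antipodal pointers on `[1, N/2)` (certified density, as for every exemplar of the lineage); every other position plays
the canonical guess toggled by `[#{odd i : x_i = 1} ≡ 0 (mod 3)] ⊕ (x₀ ∧ x₂)` (degree `≤ 6`).  Certified below: dense
(`hx_in_dense_class`), NOT counter-form at the zero gauge (`hx_not_counterForm_zero`, finite core by `decide`), and —
the point of the exhibit — of echo degree `> d` at EVERY input along EVERY admissible placement of `≥ d + 3` sites, for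
EVERY `d` simultaneously (`hx_not_echoDeg`), whence not cheaply echo-structured at the zero gauge (`hx_not_stabEcho_zero`). -/

section Inhabitant
variable {N : ℕ}

/-- the literal pair `{0, 2}`. -/
def pair02 (N : ℕ) : Finset (Fin N) := univ.filter fun i => i.val = 0 ∨ i.val = 2

/-- the cell set `pair02 N` (the cells `0` and `2` present below `N`) has at most two elements. -/
theorem pair02_card_le : (pair02 N).card ≤ 2 := by
  have h : (pair02 N).card ≤ (({0, 2} : Finset ℕ)).card :=
    Finset.card_le_card_of_injOn (fun i : Fin N => i.val)
      (fun i hi => by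
        have h := (mem_filter.1 (Finset.mem_coe.1 hi)).2
        rcases h with h | h <;> simp [h])
      (fun i _ j _ h => Fin.ext h)
  exact le_trans h (by decide)

/-- the reader bit `[Σ_odd x ≡ 0 (3)] ⊕ (x₀ ∧ x₂)`. -/
def rbit (x : Fin N → Bool) : Bool := xor (qbit x) (decide (∀ i ∈ pair02 N, x i = true))

/-- **the half-counter × literal-pair family**. -/
def hxStrat (j : Fin N) : CubeFn (ZMod 3) N :=
  if 1 ≤ j.val ∧ j.val < N / 2 then apStrat j else xorP (xorP (tPoly j) qpoly) (mono (ZMod 3) (pair02 N))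

/-- on the first half-cycle `hxStrat` IS the antipodal pointer `apStrat` (certified density). -/
theorem hxStrat_agree (n : ℕ) (j : Fin n) (h1 : 1 ≤ j.val) (h2 : j.val < n / 2) : hxStrat j = apStrat j := by
  unfold hxStrat; rw [if_pos ⟨h1, h2⟩]

/-- every `hxStrat j` has degree `≤ 6`. -/
theorem hxStrat_mem6 (j : Fin N) : hxStrat j ∈ lowDeg (ZMod 3) N 6 := by
  unfold hxStrat
  split_ifs
  · exact lowDeg_mono (by norm_num) (apStrat_mem j)
  · have h : xorP (xorP (tPoly j) qpoly) (mono (ZMod 3) (pair02 N)) ∈ lowDeg (ZMod 3) N ((2 + 2) + 2) :=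
      xorP_mem (xorP_mem (tPoly_mem j) qpoly_mem) (mono_mem_lowDeg pair02_card_le)
    exact lowDeg_mono (by norm_num) h

/-- off the first half-cycle, position `j` deviates iff the reader bit is set. -/
theorem mem_dev_hx_iff (x : Fin N → Bool) (j : Fin N) (hj : ¬ (1 ≤ j.val ∧ j.val < N / 2)) :
    j ∈ dev (fun i : Fin N => hxStrat i) x ↔ rbit x = true := by
  have happ : hxStrat j x = if xor (tGuess x j) (rbit x) then 1 else 0 := by
    unfold hxStrat rbit; rw [if_neg hj, ← Bool.xor_assoc]
    exact xorP_apply_bool _ _ x _ _ (xorP_apply_bool _ _ x _ _ (tPoly_apply j x) (qpoly_apply x))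
      (by rw [mono_apply]; by_cases h : (∀ i ∈ pair02 N, x i = true) <;> simp [h])
  simp only [Summit.QuantumAdvantage.QuantumAdvantage.Theorems.AnchorDial.dev, mem_filter, mem_univ, true_and, happ]
  generalize tGuess x j = t; generalize rbit x = q
  cases t <;> cases q <;> decide

/-- **(a) CERTIFIED DENSE** (agreement with the antipodal family on the first half-cycle), degree `6 ≤ (log₂ n)^c`. -/
theorem hx_in_dense_class (a c : ℕ) (hc : 1 ≤ c) :
    ∃ n₀ : ℕ, ∀ n ≥ n₀, (∀ i : Fin n, hxStrat i ∈ lowDeg (ZMod 3) n ((Nat.log 2 n) ^ c)) ∧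
      ¬ StabFew ((Nat.log 2 n) ^ a) 0 (c + 1) (fun j : Fin n => hxStrat j) := by
  obtain ⟨n₀, hn₀⟩ := not_polylogSparse_of_agree
    (fun n (j : Fin n) => hxStrat j) (fun n j h1 h2 => hxStrat_agree n j h1 h2) a (c + 1)
  refine ⟨max n₀ 64, fun n hn => ⟨fun i => lowDeg_mono ?_ (hxStrat_mem6 i), hn₀ n (le_trans (le_max_left _ _) hn)⟩⟩
  have h64 : 2 ^ 6 ≤ n := le_trans (le_max_right _ _) hn
  have hL : 6 ≤ Nat.log 2 n := Nat.le_log_of_pow_le (by norm_num) h64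
  calc 6 ≤ Nat.log 2 n := hL
    _ = (Nat.log 2 n) ^ 1 := (pow_one _).symm
    _ ≤ (Nat.log 2 n) ^ c := Nat.pow_le_pow_right (by omega) hc

/-! ### (b) not counter-form at the zero gauge -/

/-- the odd-cell weight vector: `Σ_odd x = lin lw x`. -/
def lw (i : Fin N) : ZMod 3 := if i.val % 2 = 1 then 1 else 0

/-- `lodd` is the `Z₃`-linear form with coefficient vector `lw` (ones on the odd cells). -/
theorem lodd_eq_lin (x : Fin N → Bool) : (lodd : CubeFn (ZMod 3) N) x = lin lw x := by
  rw [lodd_eq_sum]; unfold lin lw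
  rw [Finset.sum_filter]
  refine sum_congr rfl fun j _ => ?_
  by_cases h1 : j.val % 2 = 1 <;> by_cases h2 : x j = true <;> simp [h1, h2]

/-- the literal pair on `xloc ξ`. -/
theorem pair02_xloc (h5 : 5 ≤ N) (ξ : Fin 5 → Bool) :
    (∀ i ∈ pair02 N, xloc ξ i = true) ↔ (ξ ⟨0, by norm_num⟩ && ξ ⟨2, by norm_num⟩) = true := by
  rw [Bool.and_eq_true]
  constructor
  · intro h
    refine ⟨?_, ?_⟩
    · have := h ⟨0, by omega⟩ (mem_filter.2 ⟨mem_univ _, by simp⟩); simpa [xloc] using this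
    · have := h ⟨2, by omega⟩ (mem_filter.2 ⟨mem_univ _, by simp⟩); simpa [xloc] using this
  · rintro ⟨h0, h2⟩ i hi
    have hi' := (mem_filter.1 hi).2
    have hlt : i.val < 5 := by omega
    rw [show i = Fin.castLE h5 ⟨i.val, hlt⟩ from Fin.ext (by simp), xloc_castLE]
    rcases hi' with h | h
    · rw [show (⟨i.val, hlt⟩ : Fin 5) = ⟨0, by norm_num⟩ from Fin.ext h]; exact h0
    · rw [show (⟨i.val, hlt⟩ : Fin 5) = ⟨2, by norm_num⟩ from Fin.ext h]; exact h2

set_option maxHeartbeats 1600000 in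
/-- the finite core: no `Z₃`-linear level set agrees with `[ρ' + ξ₁ + ξ₃ ≡ 0] ⊕ (ξ₀ ∧ ξ₂)` on the odd local inputs
(a `decide` over `3⁷ · 2³` cases; kernel-checked, about three times the size of the tree's `cube_core`). -/
theorem hx_core : ∀ ρ' δ₀ δ₁ δ₂ δ₃ δ₄ ρ : ZMod 3, ∀ A₀ A₁ A₂ : Bool, ∃ ξ₀ ξ₁ ξ₂ ξ₃ ξ₄ : Bool,
    ((!ξ₀).toNat + (!ξ₁).toNat + (!ξ₂).toNat + (!ξ₃).toNat + (!ξ₄).toNat) % 2 = 1 ∧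
      xor (decide (ρ' + ((if ξ₀ then (0 : ZMod 3) else 0) + (if ξ₁ then 1 else 0) + (if ξ₂ then 0 else 0) +
        (if ξ₃ then 1 else 0) + (if ξ₄ then 0 else 0)) = 0)) (ξ₀ && ξ₂) ≠
        bsel A₀ A₁ A₂ (ρ + ((if ξ₀ then δ₀ else 0) + (if ξ₁ then δ₁ else 0) +
          (if ξ₂ then δ₂ else 0) + (if ξ₃ then δ₃ else 0) + (if ξ₄ then δ₄ else 0))) := by
  decide

/-- **the family is NOT in counter form at the zero gauge** (`N ≥ 6`). -/
theorem hx_not_counterForm (hN : 6 ≤ N) (a : Fin N → Fin N → ZMod 3) (A : Fin N → Finset (ZMod 3)) :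
    ¬ CounterForm a A (pad (fun i : Fin N => hxStrat i) (fun _ => 0)) := by
  intro hF
  have h5 : 5 ≤ N := by omega
  set k₀ : Fin N := ⟨N - 1, by omega⟩ with hk₀
  have hk : ¬ (1 ≤ k₀.val ∧ k₀.val < N / 2) := by simp only [hk₀]; omega
  set v := a k₀ with hv
  set c : Fin 5 → Fin N := Fin.castLE h5 with hc
  set ρ : ZMod 3 := ∑ i ∈ univ.filter (fun i : Fin N => ¬ i.val < 5), v i with hρ
  set ρ' : ZMod 3 := ∑ i ∈ univ.filter (fun i : Fin N => ¬ i.val < 5), lw i with hρ'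
  obtain ⟨ξ₀, ξ₁, ξ₂, ξ₃, ξ₄, hpar, hne⟩ := hx_core ρ' (v (c 0)) (v (c 1)) (v (c 2)) (v (c 3)) (v (c 4)) ρ
    (decide ((0 : ZMod 3) ∈ A k₀)) (decide ((1 : ZMod 3) ∈ A k₀)) (decide ((2 : ZMod 3) ∈ A k₀))
  set ξ : Fin 5 → Bool := ![ξ₀, ξ₁, ξ₂, ξ₃, ξ₄] with hξ
  have hodd : OddZeros (xloc ξ : Fin N → Bool) := by
    rw [oddZeros_xloc h5, card_false_five]; exact hpar
  have h := hF (xloc ξ) hodd k₀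
  have hrb : rbit (xloc ξ : Fin N → Bool) =
      xor (decide (lin lw (xloc ξ : Fin N → Bool) = 0)) (ξ ⟨0, by norm_num⟩ && ξ ⟨2, by norm_num⟩) := by
    unfold rbit qbit; rw [lodd_eq_lin]; congr 1
    rw [Bool.eq_iff_iff, decide_eq_true_iff, pair02_xloc h5]
  rw [dev_pad_zero, mem_dev_hx_iff _ k₀ hk, hrb, mem_iff_bsel, lin_xloc h5, lin_xloc h5, Fin.sum_univ_five,
    Fin.sum_univ_five] at h
  have hw0 : lw (c 0) = 0 := by simp [lw, hc]
  have hw1 : lw (c 1) = 1 := by simp [lw, hc]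
  have hw2 : lw (c 2) = 0 := by simp [lw, hc]
  have hw3 : lw (c 3) = 1 := by simp [lw, hc]
  have hw4 : lw (c 4) = 0 := by simp [lw, hc]
  rw [hw0, hw1, hw2, hw3, hw4] at h
  apply hne
  rw [Bool.eq_iff_iff]
  exact h

/-- hence not cheaply counter-form AT THE ZERO GAUGE. -/
theorem hx_not_counterForm_zero (hN : 6 ≤ N) :
    ¬ ∃ (a : Fin N → Fin N → ZMod 3) (A : Fin N → Finset (ZMod 3)),
      CounterForm a A (pad (fun i : Fin N => hxStrat i) (fun _ => 0)) := by
  rintro ⟨a, A, h⟩; exact hx_not_counterForm hN a A h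

/-! ### (c) high echo: the reader's echo has `𝔽₂`-degree `> d` at EVERY input along EVERY placement of `≥ d+3` sites

Ingredients: (i) echo degree can only drop on a sub-orbit (`echoDeg_castLE`), so we may work with the first `d + 3`
sites; (ii) along the orbit the counter moves by `Σ_{i ∈ ε} ±1` (`lodd_orbF_gen`) and the literal pair `x₀ ∧ x₂` only
sees the first two sites; (iii) SUBCUBE PARITY: a degree-`≤ d` polynomial has even weight on every `(d+1)`-subcube
(`even_mono_count` + double counting), whereas (iv) the `Z₃`-counter slice `[a + Σ_t s_t τ_t ≡ 0]` has ODD weight on the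
`(d+1)`-cube for some residue `a` (`cnt3_parity`: the parity vector over `a ∈ Z₃` is never constant), and every residue
is reached by setting the first two sites (`reach3`). -/

/-- number of points of the `m`-cube at which the weighted `Z₃`-counter `a + Σ_t s_t τ_t` vanishes. -/
def cnt3 {m : ℕ} (s : Fin m → ZMod 3) (a : ZMod 3) : ℕ :=
  (univ.filter fun τ : Fin m → Bool => a + ∑ t, (if τ t then s t else 0) = 0).card

/-- base case of the subcube count: with no free cells, `cnt3 s a` is odd iff `a = 0`. -/
theorem cnt3_zero (s : Fin 0 → ZMod 3) (a : ZMod 3) : cnt3 s a % 2 = if a = 0 then 1 else 0 := by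
  unfold cnt3
  by_cases ha : a = 0
  · rw [if_pos ha]
    have : (univ.filter fun τ : Fin 0 → Bool => a + ∑ t, (if τ t then s t else 0) = 0) = univ := by
      apply filter_true_of_mem; intro τ _; simp [ha]
    rw [this, card_univ]; simp
  · rw [if_neg ha]
    have : (univ.filter fun τ : Fin 0 → Bool => a + ∑ t, (if τ t then s t else 0) = 0) = ∅ := by
      apply filter_false_of_mem; intro τ _; simpa using ha
    rw [this, card_empty]

/-- recursion of the subcube count on the first free cell. -/
theorem cnt3_succ {m : ℕ} (s : Fin (m + 1) → ZMod 3) (a : ZMod 3) :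
    cnt3 s a = cnt3 (Fin.tail s) a + cnt3 (Fin.tail s) (a + s 0) := by
  unfold cnt3
  rw [card_filter, card_filter, card_filter]
  have hsum : ∀ (v : Bool) (τ : Fin m → Bool),
      (∑ t : Fin (m + 1), (if (Fin.cons v τ : Fin (m + 1) → Bool) t then s t else 0)) =
        (if v then s 0 else 0) + ∑ t, (if τ t then Fin.tail s t else 0) := by
    intro v τ
    rw [Fin.sum_univ_succ]
    simp only [Fin.cons_zero, Fin.cons_succ, Fin.tail]
  let e : (Fin (m + 1) → Bool) ≃ Bool × (Fin m → Bool) :=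
    ⟨fun τ => (τ 0, Fin.tail τ), fun q => Fin.cons q.1 q.2, fun τ => Fin.cons_self_tail τ,
      fun q => by ext <;> simp [Fin.tail_cons]⟩
  rw [Fintype.sum_equiv e _
    (fun q : Bool × (Fin m → Bool) =>
      if a + ∑ t, (if (Fin.cons q.1 q.2 : Fin (m + 1) → Bool) t then s t else 0) = 0 then 1 else 0)
    (fun τ => by
      show _ = (if a + ∑ t, (if (Fin.cons (τ 0) (Fin.tail τ) : Fin (m + 1) → Bool) t then s t else 0) = 0
        then 1 else 0)
      rw [Fin.cons_self_tail])]
  rw [Fintype.sum_prod_type, Fintype.sum_bool, add_comm]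
  simp only [hsum]
  congr 1
  · refine Fintype.sum_congr _ _ fun τ => ?_
    simp
  · refine Fintype.sum_congr _ _ fun τ => ?_
    simp only [ite_true, ← add_assoc]

/-- three steps of a non-zero residue return. -/
theorem zmod3_three_steps (a t : ZMod 3) : a + t + t + t = a := by revert a t; decide

/-- a non-zero residue generates. -/
theorem zmod3_orbit (a₁ a₂ t : ZMod 3) (ht : t ≠ 0) : a₂ = a₁ ∨ a₂ = a₁ + t ∨ a₂ = a₁ + t + t := by
  revert a₁ a₂ t; decide

/-- **period-3 parity lemma**: for non-zero weights the parity of `cnt3 s a` is NOT constant in `a ∈ Z₃`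
(so some residue class of the weighted counter has odd size on the cube, and some has even size). -/
theorem cnt3_parity : ∀ {m : ℕ} (s : Fin m → ZMod 3), (∀ t, s t ≠ 0) →
    (∃ a, cnt3 s a % 2 = 1) ∧ (∃ a, cnt3 s a % 2 = 0)
  | 0, s, _ => ⟨⟨0, by rw [cnt3_zero]; simp⟩, ⟨1, by rw [cnt3_zero]; decide⟩⟩
  | m + 1, s, hs => by
    have hs' : ∀ t, Fin.tail s t ≠ 0 := fun t => hs t.succ
    obtain ⟨⟨a₁, h₁⟩, ⟨a₂, h₂⟩⟩ := cnt3_parity (Fin.tail s) hs'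
    have h0 : s 0 ≠ 0 := hs 0
    constructor
    · by_contra hall
      push Not at hall
      have hsame : ∀ a, cnt3 (Fin.tail s) a % 2 = cnt3 (Fin.tail s) (a + s 0) % 2 := by
        intro a; have := hall a; rw [cnt3_succ] at this; omega
      have e1 := hsame a₁
      have e2 := hsame (a₁ + s 0)
      rcases zmod3_orbit a₁ a₂ (s 0) h0 with h | h | h <;> rw [h] at h₂ <;> omega
    · by_contra hall
      push Not at hall
      have hdiff : ∀ a, cnt3 (Fin.tail s) a % 2 ≠ cnt3 (Fin.tail s) (a + s 0) % 2 := by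
        intro a; have := hall a; rw [cnt3_succ] at this; omega
      have e1 := hdiff a₁
      have e2 := hdiff (a₁ + s 0)
      have e3 := hdiff (a₁ + s 0 + s 0)
      rw [zmod3_three_steps] at e3
      omega

/-- the first two sites reach every residue. -/
theorem reach3 (L s₀ s₁ a : ZMod 3) (h₀ : s₀ ≠ 0) (h₁ : s₁ ≠ 0) :
    ∃ p q : Bool, L + (if p then s₀ else 0) + (if q then s₁ else 0) = a := by
  revert L s₀ s₁ a; decide

/-! #### restriction to a sub-orbit -/

/-- extension by `false` of a sign pattern on the first `F'` sites. -/
def extF {F F' : ℕ} (_h : F' ≤ F) (ε' : Fin F' → Bool) (i : Fin F) : Bool :=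
  if hi : i.val < F' then ε' ⟨i.val, hi⟩ else false

/-- extending a flag vector from `F'` to `F` sites and reading it back on the first `F'` sites is the identity. -/
theorem extF_castLE {F F' : ℕ} (h : F' ≤ F) (ε' : Fin F' → Bool) (i' : Fin F') :
    extF h ε' (Fin.castLE h i') = ε' i' := by
  simp only [extF, Fin.val_castLE, i'.isLt, dif_pos]

/-- flipping by an extended flag vector is flipping along the restricted (initial) site family. -/
theorem orbF_extF {F F' : ℕ} {b : Fin F → ℕ} (hb : ∀ i j : Fin F, i < j → b i + 2 ≤ b j) (h : F' ≤ F)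
    (ε' : Fin F' → Bool) (x : Fin N → Bool) :
    orbF b (extF h ε') x = orbF (fun i' : Fin F' => b (Fin.castLE h i')) ε' x := by
  have hb' : ∀ i j : Fin F', i < j → b (Fin.castLE h i) + 2 ≤ b (Fin.castLE h j) := fun i j hij => hb _ _ hij
  funext j
  rw [orbF_apply hb, orbF_apply hb']
  have hiff : (∃ i, extF h ε' i = true ∧ (j.val = b i ∨ j.val = b i + 1)) ↔
      (∃ i' : Fin F', ε' i' = true ∧ (j.val = b (Fin.castLE h i') ∨ j.val = b (Fin.castLE h i') + 1)) := by
    constructor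
    · rintro ⟨i, hi, hj⟩
      by_cases hlt : i.val < F'
      · refine ⟨⟨i.val, hlt⟩, by simpa [extF, hlt] using hi, ?_⟩
        have e : Fin.castLE h ⟨i.val, hlt⟩ = i := Fin.ext (by simp)
        rw [e]; exact hj
      · simp [extF, hlt] at hi
    · rintro ⟨i', hi', hj⟩
      exact ⟨Fin.castLE h i', by rw [extF_castLE]; exact hi', hj⟩
  by_cases hc : ∃ i, extF h ε' i = true ∧ (j.val = b i ∨ j.val = b i + 1)
  · rw [if_pos hc, if_pos (hiff.1 hc)]
  · rw [if_neg hc, if_neg (fun h' => hc (hiff.2 h'))]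

/-- an initial segment of an admissible site family is admissible. -/
theorem sitesF_castLE {F F' : ℕ} (h : F' ≤ F) {b : Fin F → ℕ} (hb : SitesF N F b) :
    SitesF N F' (fun i' => b (Fin.castLE h i')) :=
  ⟨fun _ _ hij => hb.1 _ _ hij, fun _ => hb.2 _⟩

/-- **echo degree can only drop on a sub-orbit**: restricting to the first `F'` sites keeps `EchoDeg d`. -/
theorem echoDeg_castLE {F F' d : ℕ} (h : F' ≤ F) {b : Fin F → ℕ} (hb : ∀ i j : Fin F, i < j → b i + 2 ≤ b j)
    (P : Fin N → CubeFn (ZMod 3) N) (x : Fin N → Bool) (hE : EchoDeg d b P x) :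
    EchoDeg d (fun i' : Fin F' => b (Fin.castLE h i')) P x := by
  intro k
  obtain ⟨M, hMd, hM⟩ := hE k
  refine ⟨univ.filter (fun S' : Finset (Fin F') => S'.map (Fin.castLEEmb h) ∈ M), fun S' hS' => ?_, fun ε' => ?_⟩
  · have := hMd _ (mem_filter.1 hS').2; rwa [card_map] at this
  · rw [← orbF_extF hb h ε' x, hM (extF h ε')]
    suffices hc : (M.filter fun S => ∀ i ∈ S, extF h ε' i = true).card =
        ((univ.filter fun S' : Finset (Fin F') => S'.map (Fin.castLEEmb h) ∈ M).filter
          fun S' => ∀ i ∈ S', ε' i = true).card by rw [hc]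
    symm
    rw [← card_image_of_injective _ (Finset.map_injective (Fin.castLEEmb h))]
    congr 1
    ext S
    simp only [mem_image, mem_filter, mem_univ, true_and]
    constructor
    · rintro ⟨S', ⟨hS'M, hS'ε⟩, rfl⟩
      refine ⟨hS'M, fun i hi => ?_⟩
      obtain ⟨i', hi', rfl⟩ := mem_map.1 hi
      rw [Fin.castLEEmb_apply, extF_castLE]; exact hS'ε i' hi'
    · rintro ⟨hSM, hSε⟩
      have e : (univ.filter fun i' : Fin F' => Fin.castLE h i' ∈ S).map (Fin.castLEEmb h) = S := by
        ext i
        simp only [mem_map, mem_filter, mem_univ, true_and, Fin.castLEEmb_apply]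
        constructor
        · rintro ⟨i', hi'S, rfl⟩; exact hi'S
        · intro hiS
          have hlt : i.val < F' := by
            by_contra hn; have := hSε i hiS; simp [extF, hn] at this
          refine ⟨⟨i.val, hlt⟩, ?_, Fin.ext (by simp)⟩
          have e' : Fin.castLE h ⟨i.val, hlt⟩ = i := Fin.ext (by simp)
          rw [e']; exact hiS
      refine ⟨univ.filter (fun i' : Fin F' => Fin.castLE h i' ∈ S), ⟨by rw [e]; exact hSM, fun i' hi' => ?_⟩, e⟩
      have := hSε _ (mem_filter.1 hi').2
      rwa [extF_castLE] at this

end Inhabitant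

end Summit.QuantumAdvantage.QuantumAdvantage.Theorems.EchoDial
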